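import Mathlib
import HarnessLib
import Summits.Ventures.LatticeQCDFlow.Exactness.LatticeStencilConditioner

/-!
# WINDOW-STENCIL CONDITIONERS WITH SMOOTH FEATURES AND A SMOOTH READOUT ARE SMOOTH ALONG LINK FIELDS: the analytic hypotheses (ρD)/(ρC) of the GEN-16 volume-uniformity chain REDUCE TO THE PIECES — `SU(2)` plaquette holonomies of link-smooth fields are smooth, hence so are per-site features and any readout that is smooth along coordinatewise-smooth families

HONEST FRAMING: exact (Metropolis-corrected) sampling algorithms for lattice gauge theory;
figures of merit are autocorrelation/cost numbers at stated couplings and volumes; no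
continuum-physics claim.

Venture `LatticeQCDFlow` (cell pub-lqcd), topic `Exactness`; FANOUT row 14 (`eng-flowhmc`, engine
`latflow.fthmc`, family B; the learned residual member's conditioner = frozen-plaquette features per site
+ a periodic CNN of depth `m` + `(κ/(2(d−1))) tanh`).  NEW WORK of the cell over the tree
(`LatticeStencilConditioner` — the window-stencil
family `ρ^{(M)}_s(V)(e,ν,t) = ψ s e.2 ν t (z ↦ feat s (Σⱼ(e.1+z)ⱼ mod w) ((μ',ν') ↦ U_{μ'ν'}(V)(e.1+z)))`,
`|zᵢ| ≤ m`, whose geometric hypotheses (ρN)/(ρT)/(ρL), mask-locality (ρloc) and measurability (ρm) are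
typed there); nothing is cited as a fact; no number.  GEN-17: `SU2ResidualStencilVolumeUniform` /
`SU2ResidualSquashStencilVolumeUniform` keep the two ANALYTIC hypotheses of the chain —
(ρD) «the weights are differentiable along differentiable link fields» and (ρC) «`C^n` along `C^n` link
fields» — as stated, for the COMPOSITE `ψ ∘ (window of feat ∘ plaquettes)`.  Here they are DERIVED from
the same two properties of the PIECES:

* **`contDiffAt_coe_plaquetteHolonomy_sun_of_links`** / **`differentiableAt_coe_plaquetteHolonomy_sun_of_links`**
  — if every link of a `p`-dependent `SU(N)` field (any `N`) is `C^n` (differentiable) at `p₀` as a matrix,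
  so is every plaquette holonomy `U_{μν}(V(p))(x)` (products and conjugate transposes,
  `contDiff_conjTranspose_sun`);
* **`stencilConditioner_family_contDiff`** — (ρC) for the stencil family on EVERY torus `M`, from
  (featC) «`q ↦ feat s c (P(q))` is `C^n` at `q₀` whenever every plaquette entry `q ↦ P(q)_{μ'ν'}` is» and
  (ψC) «`q ↦ ψ s μ ν t (G(q))` is `C^n` at `q₀` whenever every window entry `q ↦ G(q)(z)` is» — smoothness
  ALONG COORDINATEWISE-SMOOTH FAMILIES (parameter spaces `P : Type`), which is what ordinary `C^n`-ness
  of `feat s c` on `(M₂(ℂ))^{d×d}` and of `ψ s μ ν t` on `Φ^{window}` give by the chain rule, and which is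
  stated this way only because the window `{z : Fin d → ℤ // |zᵢ| ≤ m}` carries no `Fintype` instance
  (so `window → Φ` is not a normed space in Mathlib's eyes);
* **`stencilConditioner_family_differentiable`** — (ρD) likewise from (featD), (ψD);
* **`stencilConditioner_contDiff`** / **`stencilConditioner_differentiable`** — the same ON ONE TORUS for ANY
  colouring `χ` (the single-torus hypotheses of `SU2ResidualExactForceCovering` / `…Locality`);
* **`selectionReadout_contDiff/_differentiable`**, **`matrixFeature_contDiff/_differentiable`** (§5) — the
  along-families hypotheses FROM ORDINARY smoothness: readouts that are smooth functions of finitely many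
  window entries (every network on the flattened window), feature maps that are smooth functions of the
  plaquettes' matrix entries; **`maskedFeature_frozen`** (§4) — masked feature maps have the
  frozen-feature property BY CONSTRUCTION;
* **`squashReadout_contDiff`** / **`squashReadout_differentiable`** — the engine's squashed readout
  `(s, μ, ν, t, F) ↦ (κ_t/(2(d−1)))·tanh (Ψ s μ ν t F)` inherits (ψC)/(ψD) from `Ψ` (`tanh = sinh/cosh`
  is smooth), so for the parametrisation of `SU2ResidualSquashStencilVolumeUniform` the analytic
  hypotheses reduce to those of the pre-activation network `Ψ` and of `feat`.

NOT CLAIMED: that a given checkpoint's `Ψ`/`feat` are smooth (LeakyReLU is not `C¹`; `tanh`/`GELU`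
networks and the `(Re, Im) tr` features are); anything about (ρκ), (ρloc) or the frozen-feature
property; link groups other than `SU(N)` for §1 and other than `SU(2)` for §§2–5 (the chain's hypotheses are
stated for `SU(2)`); any number.
-/

noncomputable section

namespace Summit.Ventures.LatticeQCDFlow.Exactness

open Literature.MathematicalPhysics.QuantumFieldTheory
open scoped Matrix Matrix.Norms.Operator

/-! ## §1 Plaquette holonomies of link-smooth `SU(N)` fields -/

section Plaquette

variable {d L N : ℕ} {E : Type*} [NormedAddCommGroup E] [NormedSpace ℝ E] {n : WithTop ℕ∞}

/-- Conjugate transposition of `N × N` complex matrices is `C^n` (`ℝ`-linear; the `N = 2` case is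
`SU2RetractionField.contDiff_conjTranspose_two`). -/
theorem contDiff_conjTranspose_sun : ContDiff ℝ n (fun W : Matrix (Fin N) (Fin N) ℂ => Wᴴ) := by
  let CT : Matrix (Fin N) (Fin N) ℂ →ₗ[ℝ] Matrix (Fin N) (Fin N) ℂ :=
    { toFun := fun W => Wᴴ,
      map_add' := fun A B => Matrix.conjTranspose_add A B,
      map_smul' := fun r A => by rw [Matrix.conjTranspose_smul, RingHom.id_apply, star_trivial] }
  exact (LinearMap.toContinuousLinearMap CT).contDiff

/-- **Plaquette holonomies of a link-`C^n` `SU(N)` field are `C^n`** (as matrices): products of links and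
conjugate transposes of links. -/
theorem contDiffAt_coe_plaquetteHolonomy_sun_of_links
    (U : E → GaugeConfig d L (Matrix.specialUnitaryGroup (Fin N) ℂ)) (p₀ : E)
    (hU : ∀ e : Edge d L, ContDiffAt ℝ n (fun p : E => ((U p e : (Matrix.specialUnitaryGroup (Fin N) ℂ)) : Matrix (Fin N) (Fin N) ℂ)) p₀)
    (x : Site d L) (μ ν : Fin d) :
    ContDiffAt ℝ n (fun p : E => ((plaquetteHolonomy (U p) x μ ν : (Matrix.specialUnitaryGroup (Fin N) ℂ)) : Matrix (Fin N) (Fin N) ℂ)) p₀ := by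
  have hct := contDiff_conjTranspose_sun (N := N) (n := n)
  unfold plaquetteHolonomy
  simp only [WilsonFlow.coe_mul_SU, WilsonFlow.coe_inv_SU]
  exact (((hU _).mul (hU _)).mul (hct.contDiffAt.comp p₀ (hU _))).mul (hct.contDiffAt.comp p₀ (hU _))

/-- **Plaquette holonomies of a link-differentiable `SU(N)` field are differentiable** (as matrices). -/
theorem differentiableAt_coe_plaquetteHolonomy_sun_of_links
    (U : E → GaugeConfig d L (Matrix.specialUnitaryGroup (Fin N) ℂ)) (p₀ : E)
    (hU : ∀ e : Edge d L, DifferentiableAt ℝ (fun p : E => ((U p e : (Matrix.specialUnitaryGroup (Fin N) ℂ)) : Matrix (Fin N) (Fin N) ℂ)) p₀)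
    (x : Site d L) (μ ν : Fin d) :
    DifferentiableAt ℝ (fun p : E => ((plaquetteHolonomy (U p) x μ ν : (Matrix.specialUnitaryGroup (Fin N) ℂ)) : Matrix (Fin N) (Fin N) ℂ)) p₀ := by
  have hct : Differentiable ℝ (fun W : Matrix (Fin N) (Fin N) ℂ => Wᴴ) :=
    (contDiff_conjTranspose_sun (N := N) (n := 1)).differentiable one_ne_zero
  unfold plaquetteHolonomy
  simp only [WilsonFlow.coe_mul_SU, WilsonFlow.coe_inv_SU]
  exact (((hU _).mul (hU _)).mul ((hct _).comp p₀ (hU _))).mul ((hct _).comp p₀ (hU _))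

end Plaquette

/-! ## §2 The window-stencil family: (ρC) and (ρD) from the pieces -/

section Stencil

variable {d : ℕ} {σ : Type*} {Φ : Type*} [NormedAddCommGroup Φ] [NormedSpace ℝ Φ]

/-- **(ρC) FOR WINDOW-STENCIL CONDITIONERS FROM SMOOTH PIECES**: if the per-site feature map `feat s c` is
`C^n` along every plaquette-array-valued family with `C^n` matrix entries (featC) and the readout
`ψ s μ ν t` is `C^n` along every window-array-valued family with `C^n` entries (ψC), then on EVERY torus
`M` the stencil weights `p ↦ ρ^{(M)}_s(U(p))(e,ν,b)` are `C^n` at `p₀` along every link field `U` whose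
links are `C^n` at `p₀` — literally hypothesis (ρC) of `SU2ResidualStencilVolumeUniform`. -/
theorem stencilConditioner_family_contDiff (w : ℕ) (m : ℕ)
    (feat : σ → ZMod w → (Fin d → Fin d → Matrix.specialUnitaryGroup (Fin 2) ℂ) → Φ)
    (ψ : σ → Fin d → Fin d → Fin 2 → ({z : Fin d → ℤ // ∀ i, |z i| ≤ ((m : ℕ) : ℤ)} → Φ) → ℝ)
    (hfeatC : ∀ (P : Type) [NormedAddCommGroup P] [NormedSpace ℝ P] {n : WithTop ℕ∞} (s : σ) (c : ZMod w)
      (Pl : P → Fin d → Fin d → Matrix.specialUnitaryGroup (Fin 2) ℂ) (q₀ : P),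
      (∀ μ' ν' : Fin d, ContDiffAt ℝ n (fun q : P => ((Pl q μ' ν' : (Matrix.specialUnitaryGroup (Fin 2) ℂ)) : Matrix (Fin 2) (Fin 2) ℂ)) q₀) →
      ContDiffAt ℝ n (fun q : P => feat s c (Pl q)) q₀)
    (hψC : ∀ (P : Type) [NormedAddCommGroup P] [NormedSpace ℝ P] {n : WithTop ℕ∞} (s : σ) (μ ν : Fin d) (t : Fin 2)
      (G : P → {z : Fin d → ℤ // ∀ i, |z i| ≤ ((m : ℕ) : ℤ)} → Φ) (q₀ : P),
      (∀ z, ContDiffAt ℝ n (fun q : P => G q z) q₀) → ContDiffAt ℝ n (fun q : P => ψ s μ ν t (G q)) q₀) :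
    (∀ (M : ℕ) [NeZero M] {n : WithTop ℕ∞} (s : σ) (U : (Edge d M → Matrix (Fin 2) (Fin 2) ℂ) × (Edge d M → EuclideanSpace ℝ (Fin 3)) → GaugeConfig d M (Matrix.specialUnitaryGroup (Fin 2) ℂ)) (p₀ : (Edge d M → Matrix (Fin 2) (Fin 2) ℂ) × (Edge d M → EuclideanSpace ℝ (Fin 3))),
      (∀ e : Edge d M, ContDiffAt ℝ n (fun p : (Edge d M → Matrix (Fin 2) (Fin 2) ℂ) × (Edge d M → EuclideanSpace ℝ (Fin 3)) => ((U p e : (Matrix.specialUnitaryGroup (Fin 2) ℂ)) : Matrix (Fin 2) (Fin 2) ℂ)) p₀) →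
      ∀ (e : Edge d M) (ν : Fin d) (b : Fin 2), ContDiffAt ℝ n (fun p : (Edge d M → Matrix (Fin 2) (Fin 2) ℂ) × (Edge d M → EuclideanSpace ℝ (Fin 3)) => (ψ s e.2 ν b (fun z : {z : Fin d → ℤ // ∀ i, |z i| ≤ ((m : ℕ) : ℤ)} =>
          feat s (ZMod.cast (∑ j, (e.1 + (fun i => ((z.1 i : ℤ) : ZMod M))) j) : ZMod w) (fun μ' ν' => plaquetteHolonomy (U p) (e.1 + (fun i => ((z.1 i : ℤ) : ZMod M))) μ' ν')))) p₀) := by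
  intro M _ n s U p₀ hU e ν b
  have hpl : ∀ (z : {z : Fin d → ℤ // ∀ i, |z i| ≤ ((m : ℕ) : ℤ)}) (μ' ν' : Fin d),
      ContDiffAt ℝ n (fun p : (Edge d M → Matrix (Fin 2) (Fin 2) ℂ) × (Edge d M → EuclideanSpace ℝ (Fin 3)) =>
        ((plaquetteHolonomy (U p) (e.1 + (fun i => ((z.1 i : ℤ) : ZMod M))) μ' ν' : (Matrix.specialUnitaryGroup (Fin 2) ℂ)) : Matrix (Fin 2) (Fin 2) ℂ)) p₀ :=
    fun z μ' ν' => contDiffAt_coe_plaquetteHolonomy_sun_of_links U p₀ hU _ μ' ν'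
  exact hψC _ s e.2 ν b _ p₀ fun z => hfeatC _ s _ (fun p μ' ν' => plaquetteHolonomy (U p) (e.1 + (fun i => ((z.1 i : ℤ) : ZMod M))) μ' ν') p₀ (hpl z)

/-- **(ρD) FOR WINDOW-STENCIL CONDITIONERS FROM DIFFERENTIABLE PIECES** — the same with «differentiable
at `q₀`» throughout (featD, ψD); literally hypothesis (ρD) of `SU2ResidualStencilVolumeUniform`. -/
theorem stencilConditioner_family_differentiable (w : ℕ) (m : ℕ)
    (feat : σ → ZMod w → (Fin d → Fin d → Matrix.specialUnitaryGroup (Fin 2) ℂ) → Φ)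
    (ψ : σ → Fin d → Fin d → Fin 2 → ({z : Fin d → ℤ // ∀ i, |z i| ≤ ((m : ℕ) : ℤ)} → Φ) → ℝ)
    (hfeatD : ∀ (P : Type) [NormedAddCommGroup P] [NormedSpace ℝ P] (s : σ) (c : ZMod w)
      (Pl : P → Fin d → Fin d → Matrix.specialUnitaryGroup (Fin 2) ℂ) (q₀ : P),
      (∀ μ' ν' : Fin d, DifferentiableAt ℝ (fun q : P => ((Pl q μ' ν' : (Matrix.specialUnitaryGroup (Fin 2) ℂ)) : Matrix (Fin 2) (Fin 2) ℂ)) q₀) →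
      DifferentiableAt ℝ (fun q : P => feat s c (Pl q)) q₀)
    (hψD : ∀ (P : Type) [NormedAddCommGroup P] [NormedSpace ℝ P] (s : σ) (μ ν : Fin d) (t : Fin 2)
      (G : P → {z : Fin d → ℤ // ∀ i, |z i| ≤ ((m : ℕ) : ℤ)} → Φ) (q₀ : P),
      (∀ z, DifferentiableAt ℝ (fun q : P => G q z) q₀) → DifferentiableAt ℝ (fun q : P => ψ s μ ν t (G q)) q₀) :
    (∀ (M : ℕ) [NeZero M] (s : σ) (U : (Edge d M → EuclideanSpace ℝ (Fin 3)) → GaugeConfig d M (Matrix.specialUnitaryGroup (Fin 2) ℂ))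
      (p₀ : Edge d M → EuclideanSpace ℝ (Fin 3)),
      (∀ e : Edge d M, DifferentiableAt ℝ (fun p => ((U p e : (Matrix.specialUnitaryGroup (Fin 2) ℂ)) : Matrix (Fin 2) (Fin 2) ℂ)) p₀) →
      ∀ (e : Edge d M) (ν : Fin d) (b : Fin 2), DifferentiableAt ℝ (fun p => (ψ s e.2 ν b (fun z : {z : Fin d → ℤ // ∀ i, |z i| ≤ ((m : ℕ) : ℤ)} =>
          feat s (ZMod.cast (∑ j, (e.1 + (fun i => ((z.1 i : ℤ) : ZMod M))) j) : ZMod w) (fun μ' ν' => plaquetteHolonomy (U p) (e.1 + (fun i => ((z.1 i : ℤ) : ZMod M))) μ' ν')))) p₀) := by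
  intro M _ s U p₀ hU e ν b
  have hpl : ∀ (z : {z : Fin d → ℤ // ∀ i, |z i| ≤ ((m : ℕ) : ℤ)}) (μ' ν' : Fin d),
      DifferentiableAt ℝ (fun p : Edge d M → EuclideanSpace ℝ (Fin 3) =>
        ((plaquetteHolonomy (U p) (e.1 + (fun i => ((z.1 i : ℤ) : ZMod M))) μ' ν' : (Matrix.specialUnitaryGroup (Fin 2) ℂ)) : Matrix (Fin 2) (Fin 2) ℂ)) p₀ :=
    fun z μ' ν' => differentiableAt_coe_plaquetteHolonomy_sun_of_links U p₀ hU _ μ' ν'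
  exact hψD _ s e.2 ν b _ p₀ fun z => hfeatD _ s _ (fun p μ' ν' => plaquetteHolonomy (U p) (e.1 + (fun i => ((z.1 i : ℤ) : ZMod M))) μ' ν') p₀ (hpl z)

/-- **(ρC) ON ONE TORUS, ANY COLOURING** (the single-torus hypothesis of `SU2ResidualExactForceCovering` /
`SU2ResidualExactForceLocality` for the stencil conditioner `ρ_s(V)(e,ν,t) = ψ s e.2 ν t (z ↦ feat s (χ(e.1+z)) (U_{μ'ν'}(V)(e.1+z)))`),
from (featC)/(ψC) for the pieces. -/
theorem stencilConditioner_contDiff {L : ℕ} [NeZero L] {X : Type*} (χ : Site d L → X) (m : ℕ)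
    (feat : σ → X → (Fin d → Fin d → Matrix.specialUnitaryGroup (Fin 2) ℂ) → Φ)
    (ψ : σ → Fin d → Fin d → Fin 2 → ({z : Fin d → ℤ // ∀ i, |z i| ≤ ((m : ℕ) : ℤ)} → Φ) → ℝ)
    (hfeatC : ∀ (P : Type) [NormedAddCommGroup P] [NormedSpace ℝ P] {n : WithTop ℕ∞} (s : σ) (c : X)
      (Pl : P → Fin d → Fin d → Matrix.specialUnitaryGroup (Fin 2) ℂ) (q₀ : P),
      (∀ μ' ν' : Fin d, ContDiffAt ℝ n (fun q : P => ((Pl q μ' ν' : (Matrix.specialUnitaryGroup (Fin 2) ℂ)) : Matrix (Fin 2) (Fin 2) ℂ)) q₀) →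
      ContDiffAt ℝ n (fun q : P => feat s c (Pl q)) q₀)
    (hψC : ∀ (P : Type) [NormedAddCommGroup P] [NormedSpace ℝ P] {n : WithTop ℕ∞} (s : σ) (μ ν : Fin d) (t : Fin 2)
      (G : P → {z : Fin d → ℤ // ∀ i, |z i| ≤ ((m : ℕ) : ℤ)} → Φ) (q₀ : P),
      (∀ z, ContDiffAt ℝ n (fun q : P => G q z) q₀) → ContDiffAt ℝ n (fun q : P => ψ s μ ν t (G q)) q₀) :
    ∀ {n : WithTop ℕ∞} (s : σ) (U : (Edge d L → Matrix (Fin 2) (Fin 2) ℂ) × (Edge d L → EuclideanSpace ℝ (Fin 3)) → GaugeConfig d L (Matrix.specialUnitaryGroup (Fin 2) ℂ))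
      (p₀ : (Edge d L → Matrix (Fin 2) (Fin 2) ℂ) × (Edge d L → EuclideanSpace ℝ (Fin 3))),
      (∀ e : Edge d L, ContDiffAt ℝ n (fun p : (Edge d L → Matrix (Fin 2) (Fin 2) ℂ) × (Edge d L → EuclideanSpace ℝ (Fin 3)) => ((U p e : (Matrix.specialUnitaryGroup (Fin 2) ℂ)) : Matrix (Fin 2) (Fin 2) ℂ)) p₀) →
      ∀ (e : Edge d L) (ν : Fin d) (b : Fin 2), ContDiffAt ℝ n (fun p : (Edge d L → Matrix (Fin 2) (Fin 2) ℂ) × (Edge d L → EuclideanSpace ℝ (Fin 3)) =>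
        (ψ s e.2 ν b (fun z : {z : Fin d → ℤ // ∀ i, |z i| ≤ ((m : ℕ) : ℤ)} =>
          feat s (χ (e.1 + (fun i => ((z.1 i : ℤ) : ZMod L)))) (fun μ' ν' => plaquetteHolonomy (U p) (e.1 + (fun i => ((z.1 i : ℤ) : ZMod L))) μ' ν')))) p₀ := by
  intro n s U p₀ hU e ν b
  have hpl : ∀ (z : {z : Fin d → ℤ // ∀ i, |z i| ≤ ((m : ℕ) : ℤ)}) (μ' ν' : Fin d),
      ContDiffAt ℝ n (fun p : (Edge d L → Matrix (Fin 2) (Fin 2) ℂ) × (Edge d L → EuclideanSpace ℝ (Fin 3)) =>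
        ((plaquetteHolonomy (U p) (e.1 + (fun i => ((z.1 i : ℤ) : ZMod L))) μ' ν' : (Matrix.specialUnitaryGroup (Fin 2) ℂ)) : Matrix (Fin 2) (Fin 2) ℂ)) p₀ :=
    fun z μ' ν' => contDiffAt_coe_plaquetteHolonomy_sun_of_links U p₀ hU _ μ' ν'
  exact hψC _ s e.2 ν b _ p₀ fun z => hfeatC _ s _ (fun p μ' ν' => plaquetteHolonomy (U p) (e.1 + (fun i => ((z.1 i : ℤ) : ZMod L))) μ' ν') p₀ (hpl z)

/-- **(ρD) ON ONE TORUS, ANY COLOURING**, from (featD)/(ψD) for the pieces. -/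
theorem stencilConditioner_differentiable {L : ℕ} [NeZero L] {X : Type*} (χ : Site d L → X) (m : ℕ)
    (feat : σ → X → (Fin d → Fin d → Matrix.specialUnitaryGroup (Fin 2) ℂ) → Φ)
    (ψ : σ → Fin d → Fin d → Fin 2 → ({z : Fin d → ℤ // ∀ i, |z i| ≤ ((m : ℕ) : ℤ)} → Φ) → ℝ)
    (hfeatD : ∀ (P : Type) [NormedAddCommGroup P] [NormedSpace ℝ P] (s : σ) (c : X)
      (Pl : P → Fin d → Fin d → Matrix.specialUnitaryGroup (Fin 2) ℂ) (q₀ : P),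
      (∀ μ' ν' : Fin d, DifferentiableAt ℝ (fun q : P => ((Pl q μ' ν' : (Matrix.specialUnitaryGroup (Fin 2) ℂ)) : Matrix (Fin 2) (Fin 2) ℂ)) q₀) →
      DifferentiableAt ℝ (fun q : P => feat s c (Pl q)) q₀)
    (hψD : ∀ (P : Type) [NormedAddCommGroup P] [NormedSpace ℝ P] (s : σ) (μ ν : Fin d) (t : Fin 2)
      (G : P → {z : Fin d → ℤ // ∀ i, |z i| ≤ ((m : ℕ) : ℤ)} → Φ) (q₀ : P),
      (∀ z, DifferentiableAt ℝ (fun q : P => G q z) q₀) → DifferentiableAt ℝ (fun q : P => ψ s μ ν t (G q)) q₀) :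
    ∀ (s : σ) (U : (Edge d L → EuclideanSpace ℝ (Fin 3)) → GaugeConfig d L (Matrix.specialUnitaryGroup (Fin 2) ℂ))
      (p₀ : Edge d L → EuclideanSpace ℝ (Fin 3)),
      (∀ e : Edge d L, DifferentiableAt ℝ (fun p => ((U p e : (Matrix.specialUnitaryGroup (Fin 2) ℂ)) : Matrix (Fin 2) (Fin 2) ℂ)) p₀) →
      ∀ (e : Edge d L) (ν : Fin d) (b : Fin 2), DifferentiableAt ℝ (fun p => (ψ s e.2 ν b (fun z : {z : Fin d → ℤ // ∀ i, |z i| ≤ ((m : ℕ) : ℤ)} =>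
          feat s (χ (e.1 + (fun i => ((z.1 i : ℤ) : ZMod L)))) (fun μ' ν' => plaquetteHolonomy (U p) (e.1 + (fun i => ((z.1 i : ℤ) : ZMod L))) μ' ν')))) p₀ := by
  intro s U p₀ hU e ν b
  have hpl : ∀ (z : {z : Fin d → ℤ // ∀ i, |z i| ≤ ((m : ℕ) : ℤ)}) (μ' ν' : Fin d),
      DifferentiableAt ℝ (fun p : Edge d L → EuclideanSpace ℝ (Fin 3) =>
        ((plaquetteHolonomy (U p) (e.1 + (fun i => ((z.1 i : ℤ) : ZMod L))) μ' ν' : (Matrix.specialUnitaryGroup (Fin 2) ℂ)) : Matrix (Fin 2) (Fin 2) ℂ)) p₀ :=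
    fun z μ' ν' => differentiableAt_coe_plaquetteHolonomy_sun_of_links U p₀ hU _ μ' ν'
  exact hψD _ s e.2 ν b _ p₀ fun z => hfeatD _ s _ (fun p μ' ν' => plaquetteHolonomy (U p) (e.1 + (fun i => ((z.1 i : ℤ) : ZMod L))) μ' ν') p₀ (hpl z)

end Stencil

/-! ## §3 The squashed readout `(κ_t/(2(d−1)))·tanh ∘ Ψ` inherits (ψC)/(ψD) -/

section Squash

variable {d : ℕ} {σ : Type*} {Φ : Type*} [NormedAddCommGroup Φ] [NormedSpace ℝ Φ] {m : ℕ}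

/-- **The engine's squashed readout is `C^n` along coordinatewise-`C^n` families whenever the
pre-activation network `Ψ` is** (`tanh = sinh/cosh`, `cosh > 0`). -/
theorem squashReadout_contDiff (κt : ℝ)
    (Ψ : σ → Fin d → Fin d → Fin 2 → ({z : Fin d → ℤ // ∀ i, |z i| ≤ ((m : ℕ) : ℤ)} → Φ) → ℝ)
    (hΨC : ∀ (P : Type) [NormedAddCommGroup P] [NormedSpace ℝ P] {n : WithTop ℕ∞} (s : σ) (μ ν : Fin d) (t : Fin 2)
      (G : P → {z : Fin d → ℤ // ∀ i, |z i| ≤ ((m : ℕ) : ℤ)} → Φ) (q₀ : P),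
      (∀ z, ContDiffAt ℝ n (fun q : P => G q z) q₀) → ContDiffAt ℝ n (fun q : P => Ψ s μ ν t (G q)) q₀) :
    ∀ (P : Type) [NormedAddCommGroup P] [NormedSpace ℝ P] {n : WithTop ℕ∞} (s : σ) (μ ν : Fin d) (t : Fin 2)
      (G : P → {z : Fin d → ℤ // ∀ i, |z i| ≤ ((m : ℕ) : ℤ)} → Φ) (q₀ : P),
      (∀ z, ContDiffAt ℝ n (fun q : P => G q z) q₀) →
      ContDiffAt ℝ n (fun q : P => (fun s μ ν t F => κt / (2 * ((d - 1 : ℕ) : ℝ)) * Real.tanh (Ψ s μ ν t F)) s μ ν t (G q)) q₀ := by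
  intro P _ _ n s μ ν t G q₀ hG
  have htanh : ContDiff ℝ n Real.tanh := by
    rw [show Real.tanh = fun y => Real.sinh y / Real.cosh y from funext Real.tanh_eq_sinh_div_cosh]
    exact Real.contDiff_sinh.div Real.contDiff_cosh fun y => (Real.cosh_pos y).ne'
  exact contDiffAt_const.mul (htanh.contDiffAt.comp q₀ (hΨC P s μ ν t G q₀ hG))

/-- **… and differentiable along coordinatewise-differentiable families whenever `Ψ` is.** -/
theorem squashReadout_differentiable (κt : ℝ)
    (Ψ : σ → Fin d → Fin d → Fin 2 → ({z : Fin d → ℤ // ∀ i, |z i| ≤ ((m : ℕ) : ℤ)} → Φ) → ℝ)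
    (hΨD : ∀ (P : Type) [NormedAddCommGroup P] [NormedSpace ℝ P] (s : σ) (μ ν : Fin d) (t : Fin 2)
      (G : P → {z : Fin d → ℤ // ∀ i, |z i| ≤ ((m : ℕ) : ℤ)} → Φ) (q₀ : P),
      (∀ z, DifferentiableAt ℝ (fun q : P => G q z) q₀) → DifferentiableAt ℝ (fun q : P => Ψ s μ ν t (G q)) q₀) :
    ∀ (P : Type) [NormedAddCommGroup P] [NormedSpace ℝ P] (s : σ) (μ ν : Fin d) (t : Fin 2)
      (G : P → {z : Fin d → ℤ // ∀ i, |z i| ≤ ((m : ℕ) : ℤ)} → Φ) (q₀ : P),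
      (∀ z, DifferentiableAt ℝ (fun q : P => G q z) q₀) →
      DifferentiableAt ℝ (fun q : P => (fun s μ ν t F => κt / (2 * ((d - 1 : ℕ) : ℝ)) * Real.tanh (Ψ s μ ν t F)) s μ ν t (G q)) q₀ := by
  intro P _ _ s μ ν t G q₀ hG
  have htanh : Differentiable ℝ Real.tanh := by
    rw [show Real.tanh = fun y => Real.sinh y / Real.cosh y from funext Real.tanh_eq_sinh_div_cosh]
    exact Real.differentiable_sinh.div Real.differentiable_cosh fun y => (Real.cosh_pos y).ne'
  exact (differentiableAt_const _).mul ((htanh _).comp q₀ (hΨD P s μ ν t G q₀ hG))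

end Squash

/-! ## §4 MASKED feature maps: the frozen-feature property BY CONSTRUCTION; smoothness and measurability from the raw map -/

section Mask

variable {d : ℕ} {σ : Type*} {Φ : Type*}

/-- **The frozen-feature property holds BY CONSTRUCTION for masked feature maps**: if the raw per-site
feature map `g s c` is fed the plaquette array with every NON-frozen plaquette replaced by `1` — frozen
meaning: an off-diagonal plane not containing the layer's direction `μf s`, or a site colour `c` with
`c ≠ bf s` and `c + 1 ≠ bf s` (the mask of `LatticeStencilConditioner.stencilConditioner_family_maskLocal`)
— then the resulting `feat` reads only frozen plaquettes (hypothesis `hfeat` of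
`SU2ResidualStencilVolumeUniform` / `SU2ResidualSquashStencilVolumeUniform`, VERBATIM). -/
theorem maskedFeature_frozen (w : ℕ) (μf : σ → Fin d) (bf : σ → ZMod w)
    (g : σ → ZMod w → (Fin d → Fin d → Matrix.specialUnitaryGroup (Fin 2) ℂ) → Φ) :
    ∀ (s : σ) (c : ZMod w) (P P' : Fin d → Fin d → Matrix.specialUnitaryGroup (Fin 2) ℂ),
      (∀ μ' ν' : Fin d, μ' ≠ ν' → ((μf s ≠ μ' ∧ μf s ≠ ν') ∨ (c ≠ bf s ∧ c + 1 ≠ bf s)) → P μ' ν' = P' μ' ν') →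
      (fun (s : σ) (c : ZMod w) (P : Fin d → Fin d → Matrix.specialUnitaryGroup (Fin 2) ℂ) =>
          g s c (fun μ' ν' => if μ' ≠ ν' ∧ ((μf s ≠ μ' ∧ μf s ≠ ν') ∨ (c ≠ bf s ∧ c + 1 ≠ bf s)) then P μ' ν' else 1)) s c P =
      (fun (s : σ) (c : ZMod w) (P : Fin d → Fin d → Matrix.specialUnitaryGroup (Fin 2) ℂ) =>
          g s c (fun μ' ν' => if μ' ≠ ν' ∧ ((μf s ≠ μ' ∧ μf s ≠ ν') ∨ (c ≠ bf s ∧ c + 1 ≠ bf s)) then P μ' ν' else 1)) s c P' := by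
  intro s c P P' hPP'
  simp only
  congr 1
  funext μ' ν'
  split_ifs with h
  · exact hPP' μ' ν' h.1 h.2
  · rfl

/-- **Masked feature maps are measurable when the raw map is.** -/
theorem maskedFeature_measurable [MeasurableSpace Φ] (w : ℕ) (μf : σ → Fin d) (bf : σ → ZMod w)
    (g : σ → ZMod w → (Fin d → Fin d → Matrix.specialUnitaryGroup (Fin 2) ℂ) → Φ)
    (hg : ∀ (s : σ) (c : ZMod w), Measurable (g s c)) :
    ∀ (s : σ) (c : ZMod w), Measurable ((fun (s : σ) (c : ZMod w) (P : Fin d → Fin d → Matrix.specialUnitaryGroup (Fin 2) ℂ) =>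
          g s c (fun μ' ν' => if μ' ≠ ν' ∧ ((μf s ≠ μ' ∧ μf s ≠ ν') ∨ (c ≠ bf s ∧ c + 1 ≠ bf s)) then P μ' ν' else 1)) s c) := by
  intro s c
  refine (hg s c).comp (measurable_pi_lambda _ fun μ' => measurable_pi_lambda _ fun ν' => ?_)
  by_cases h : μ' ≠ ν' ∧ ((μf s ≠ μ' ∧ μf s ≠ ν') ∨ (c ≠ bf s ∧ c + 1 ≠ bf s))
  · simp only [if_pos h]
    exact (measurable_pi_apply ν').comp (measurable_pi_apply μ')
  · simp only [if_neg h]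
    exact measurable_const

variable [NormedAddCommGroup Φ] [NormedSpace ℝ Φ]

/-- **(featC) for masked feature maps from (gC) for the raw map**: a masked entry is either the entry
itself or the constant `1`. -/
theorem maskedFeature_contDiff (w : ℕ) (μf : σ → Fin d) (bf : σ → ZMod w)
    (g : σ → ZMod w → (Fin d → Fin d → Matrix.specialUnitaryGroup (Fin 2) ℂ) → Φ)
    (hgC : ∀ (P : Type) [NormedAddCommGroup P] [NormedSpace ℝ P] {n : WithTop ℕ∞} (s : σ) (c : ZMod w)
      (Pl : P → Fin d → Fin d → Matrix.specialUnitaryGroup (Fin 2) ℂ) (q₀ : P),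
      (∀ μ' ν' : Fin d, ContDiffAt ℝ n (fun q : P => ((Pl q μ' ν' : (Matrix.specialUnitaryGroup (Fin 2) ℂ)) : Matrix (Fin 2) (Fin 2) ℂ)) q₀) →
      ContDiffAt ℝ n (fun q : P => g s c (Pl q)) q₀) :
    ∀ (P : Type) [NormedAddCommGroup P] [NormedSpace ℝ P] {n : WithTop ℕ∞} (s : σ) (c : ZMod w)
      (Pl : P → Fin d → Fin d → Matrix.specialUnitaryGroup (Fin 2) ℂ) (q₀ : P),
      (∀ μ' ν' : Fin d, ContDiffAt ℝ n (fun q : P => ((Pl q μ' ν' : (Matrix.specialUnitaryGroup (Fin 2) ℂ)) : Matrix (Fin 2) (Fin 2) ℂ)) q₀) →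
      ContDiffAt ℝ n (fun q : P => (fun (s : σ) (c : ZMod w) (P : Fin d → Fin d → Matrix.specialUnitaryGroup (Fin 2) ℂ) =>
          g s c (fun μ' ν' => if μ' ≠ ν' ∧ ((μf s ≠ μ' ∧ μf s ≠ ν') ∨ (c ≠ bf s ∧ c + 1 ≠ bf s)) then P μ' ν' else 1)) s c (Pl q)) q₀ := by
  intro P _ _ n s c Pl q₀ hPl
  refine hgC P s c (fun q μ' ν' => if μ' ≠ ν' ∧ ((μf s ≠ μ' ∧ μf s ≠ ν') ∨ (c ≠ bf s ∧ c + 1 ≠ bf s)) then Pl q μ' ν' else 1) q₀ fun μ' ν' => ?_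
  by_cases h : μ' ≠ ν' ∧ ((μf s ≠ μ' ∧ μf s ≠ ν') ∨ (c ≠ bf s ∧ c + 1 ≠ bf s))
  · simp only [if_pos h]
    exact hPl μ' ν'
  · simp only [if_neg h]
    exact contDiffAt_const

/-- **(featD) for masked feature maps from (gD) for the raw map.** -/
theorem maskedFeature_differentiable (w : ℕ) (μf : σ → Fin d) (bf : σ → ZMod w)
    (g : σ → ZMod w → (Fin d → Fin d → Matrix.specialUnitaryGroup (Fin 2) ℂ) → Φ)
    (hgD : ∀ (P : Type) [NormedAddCommGroup P] [NormedSpace ℝ P] (s : σ) (c : ZMod w)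
      (Pl : P → Fin d → Fin d → Matrix.specialUnitaryGroup (Fin 2) ℂ) (q₀ : P),
      (∀ μ' ν' : Fin d, DifferentiableAt ℝ (fun q : P => ((Pl q μ' ν' : (Matrix.specialUnitaryGroup (Fin 2) ℂ)) : Matrix (Fin 2) (Fin 2) ℂ)) q₀) →
      DifferentiableAt ℝ (fun q : P => g s c (Pl q)) q₀) :
    ∀ (P : Type) [NormedAddCommGroup P] [NormedSpace ℝ P] (s : σ) (c : ZMod w)
      (Pl : P → Fin d → Fin d → Matrix.specialUnitaryGroup (Fin 2) ℂ) (q₀ : P),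
      (∀ μ' ν' : Fin d, DifferentiableAt ℝ (fun q : P => ((Pl q μ' ν' : (Matrix.specialUnitaryGroup (Fin 2) ℂ)) : Matrix (Fin 2) (Fin 2) ℂ)) q₀) →
      DifferentiableAt ℝ (fun q : P => (fun (s : σ) (c : ZMod w) (P : Fin d → Fin d → Matrix.specialUnitaryGroup (Fin 2) ℂ) =>
          g s c (fun μ' ν' => if μ' ≠ ν' ∧ ((μf s ≠ μ' ∧ μf s ≠ ν') ∨ (c ≠ bf s ∧ c + 1 ≠ bf s)) then P μ' ν' else 1)) s c (Pl q)) q₀ := by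
  intro P _ _ s c Pl q₀ hPl
  refine hgD P s c (fun q μ' ν' => if μ' ≠ ν' ∧ ((μf s ≠ μ' ∧ μf s ≠ ν') ∨ (c ≠ bf s ∧ c + 1 ≠ bf s)) then Pl q μ' ν' else 1) q₀ fun μ' ν' => ?_
  by_cases h : μ' ≠ ν' ∧ ((μf s ≠ μ' ∧ μf s ≠ ν') ∨ (c ≠ bf s ∧ c + 1 ≠ bf s))
  · simp only [if_pos h]
    exact hPl μ' ν'
  · simp only [if_neg h]
    exact differentiableAt_const _

end Mask

/-! ## §5 From ORDINARY smoothness to the along-families form: readouts of finitely many window entries, features through the matrix entries -/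

section Bridge

variable {d : ℕ} {σ : Type*} {Φ : Type*} [NormedAddCommGroup Φ] [NormedSpace ℝ Φ] {m : ℕ}

/-- **(ψC) from ordinary smoothness**: a readout that is a `C^n` function (every `n`) of FINITELY MANY
window entries `F (zsel k)`, `k : Fin K` — every network on the flattened window is one, with `zsel` an
enumeration — is `C^n` along every coordinatewise-`C^n` family. -/
theorem selectionReadout_contDiff {K : ℕ} (zsel : Fin K → {z : Fin d → ℤ // ∀ i, |z i| ≤ ((m : ℕ) : ℤ)})
    (h : σ → Fin d → Fin d → Fin 2 → (Fin K → Φ) → ℝ)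
    (hh : ∀ (s : σ) (μ ν : Fin d) (t : Fin 2) {n : WithTop ℕ∞}, ContDiff ℝ n (h s μ ν t)) :
    ∀ (P : Type) [NormedAddCommGroup P] [NormedSpace ℝ P] {n : WithTop ℕ∞} (s : σ) (μ ν : Fin d) (t : Fin 2)
      (G : P → {z : Fin d → ℤ // ∀ i, |z i| ≤ ((m : ℕ) : ℤ)} → Φ) (q₀ : P),
      (∀ z, ContDiffAt ℝ n (fun q : P => G q z) q₀) →
      ContDiffAt ℝ n (fun q : P => (fun s μ ν t (F : {z : Fin d → ℤ // ∀ i, |z i| ≤ ((m : ℕ) : ℤ)} → Φ) => h s μ ν t (fun k => F (zsel k))) s μ ν t (G q)) q₀ := by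
  intro P _ _ n s μ ν t G q₀ hG
  exact (hh s μ ν t).contDiffAt.comp q₀ (contDiffAt_pi.2 fun k => hG (zsel k))

/-- **(ψD) from ordinary differentiability** of a readout of finitely many window entries. -/
theorem selectionReadout_differentiable {K : ℕ} (zsel : Fin K → {z : Fin d → ℤ // ∀ i, |z i| ≤ ((m : ℕ) : ℤ)})
    (h : σ → Fin d → Fin d → Fin 2 → (Fin K → Φ) → ℝ)
    (hh : ∀ (s : σ) (μ ν : Fin d) (t : Fin 2), Differentiable ℝ (h s μ ν t)) :
    ∀ (P : Type) [NormedAddCommGroup P] [NormedSpace ℝ P] (s : σ) (μ ν : Fin d) (t : Fin 2)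
      (G : P → {z : Fin d → ℤ // ∀ i, |z i| ≤ ((m : ℕ) : ℤ)} → Φ) (q₀ : P),
      (∀ z, DifferentiableAt ℝ (fun q : P => G q z) q₀) →
      DifferentiableAt ℝ (fun q : P => (fun s μ ν t (F : {z : Fin d → ℤ // ∀ i, |z i| ≤ ((m : ℕ) : ℤ)} → Φ) => h s μ ν t (fun k => F (zsel k))) s μ ν t (G q)) q₀ := by
  intro P _ _ s μ ν t G q₀ hG
  exact ((hh s μ ν t) _).comp q₀ (differentiableAt_pi.2 fun k => hG (zsel k))

/-- **(featC) from ordinary smoothness**: a feature map that is a `C^n` function (every `n`) of the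
plaquettes' MATRIX ENTRIES is `C^n` along every plaquette-array family with `C^n` entries. -/
theorem matrixFeature_contDiff {X : Type*} (F : σ → X → (Fin d → Fin d → Matrix (Fin 2) (Fin 2) ℂ) → Φ)
    (hF : ∀ (s : σ) (c : X) {n : WithTop ℕ∞}, ContDiff ℝ n (F s c)) :
    ∀ (P : Type) [NormedAddCommGroup P] [NormedSpace ℝ P] {n : WithTop ℕ∞} (s : σ) (c : X)
      (Pl : P → Fin d → Fin d → Matrix.specialUnitaryGroup (Fin 2) ℂ) (q₀ : P),
      (∀ μ' ν' : Fin d, ContDiffAt ℝ n (fun q : P => ((Pl q μ' ν' : (Matrix.specialUnitaryGroup (Fin 2) ℂ)) : Matrix (Fin 2) (Fin 2) ℂ)) q₀) →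
      ContDiffAt ℝ n (fun q : P => (fun (s : σ) (c : X) (Q : Fin d → Fin d → Matrix.specialUnitaryGroup (Fin 2) ℂ) =>
          F s c (fun μ' ν' => ((Q μ' ν' : (Matrix.specialUnitaryGroup (Fin 2) ℂ)) : Matrix (Fin 2) (Fin 2) ℂ))) s c (Pl q)) q₀ := by
  intro P _ _ n s c Pl q₀ hPl
  exact (hF s c).contDiffAt.comp q₀ (contDiffAt_pi.2 fun μ' => contDiffAt_pi.2 fun ν' => hPl μ' ν')

/-- **(featD) from ordinary differentiability** of a feature map through the matrix entries. -/
theorem matrixFeature_differentiable {X : Type*} (F : σ → X → (Fin d → Fin d → Matrix (Fin 2) (Fin 2) ℂ) → Φ)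
    (hF : ∀ (s : σ) (c : X), Differentiable ℝ (F s c)) :
    ∀ (P : Type) [NormedAddCommGroup P] [NormedSpace ℝ P] (s : σ) (c : X)
      (Pl : P → Fin d → Fin d → Matrix.specialUnitaryGroup (Fin 2) ℂ) (q₀ : P),
      (∀ μ' ν' : Fin d, DifferentiableAt ℝ (fun q : P => ((Pl q μ' ν' : (Matrix.specialUnitaryGroup (Fin 2) ℂ)) : Matrix (Fin 2) (Fin 2) ℂ)) q₀) →
      DifferentiableAt ℝ (fun q : P => (fun (s : σ) (c : X) (Q : Fin d → Fin d → Matrix.specialUnitaryGroup (Fin 2) ℂ) =>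
          F s c (fun μ' ν' => ((Q μ' ν' : (Matrix.specialUnitaryGroup (Fin 2) ℂ)) : Matrix (Fin 2) (Fin 2) ℂ))) s c (Pl q)) q₀ := by
  intro P _ _ s c Pl q₀ hPl
  exact ((hF s c) _).comp q₀ (differentiableAt_pi.2 fun μ' => differentiableAt_pi.2 fun ν' => hPl μ' ν')

end Bridge

end Summit.Ventures.LatticeQCDFlow.Exactness
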